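import Literature.Algebra.Homology.OrderedCechContraction
import Literature.Algebra.Homology.OrderedCechMap
import HarnessLib

/-!
# Acyclicity of the ordered Čech complex: the partition-of-unity criterion cochain by cochain
# (Stacks Project, Tag 01X9)

`Literature/Algebra/Homology/OrderedCechContraction` proves the homotopy identity
`d h + h d = r` for the cone contraction of the ordered Čech complex `Č•(F)` of a monotone family
`F : Finset ι → Submodule A 𝕂` twisted by an endomorphism `r` of `𝕂` with `r (F (s ∪ i)) ⊆ F s`,
and the resulting partition-of-unity acyclicity criterion. For the Čech complex of a
quasi-coherent module `𝓕` on an affine scheme `Spec R` covered by `(W_i)`, `D(f) ⊆ W_i`, that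
uniform hypothesis fails (`Γ(W_s ∩ D(f), 𝓕) = Γ(W_s, 𝓕)_f` and no single power `fᴺ` clears all
denominators), but for each *single* cochain `c` some power does, its finitely many components
lying in `Γ(W_s, 𝓕)_f`. This file records the criterion in that form:

* `OrderedCech.exists_d_eq_of_partition_of_cochain` — if `c ∈ Čⁿ⁺¹(F)` is a cocycle and there
  are finitely many `A`-linear endomorphisms `r_k`, `a_k` of `𝕂` and vertices `i_k` with
  `r_k (c_{τ ∪ i_k}) ∈ F τ` for every `n`-simplex `τ ∌ i_k` (a condition on the components of
  `c` only), `a_k (F s) ⊆ F s`, and `Σ_k a_k (r_k (c_σ)) = c_σ` on the components of `c`, then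
  `c = d b` for some `b ∈ Čⁿ(F)`. Proof: in the Čech complex of the constant family `s ↦ 𝕂` (where
  the hypotheses of the contraction hold trivially) `b' = Σ_k a_k h_k c` has `d b' = c` by
  `d_coneHom_add_coneHom_d`, and its components lie in the `F τ`; the inclusion `Č(F) ↪ Č(𝕂)`
  (`Literature/Algebra/Homology/OrderedCechMap`) is injective and commutes with `d`;
* `OrderedCech.exactAt_of_forall_exists_d_eq` — bookkeeping: `Č•(F)` is exact in all degrees
  `≠ 0` as soon as every cocycle of positive degree is a coboundary.

This is the algebraic skeleton of the vanishing of the higher Čech cohomology of quasi-coherent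
modules on affine schemes (Stacks Project, Tag 01X9, whose proof runs the same homotopy after
localizing at a prime; Görtz–Wedhorn II, Thm. 22.2), applied to `𝒪_X(D)` in
`Literature/AlgebraicGeometry/Motives/CartierDivisorCechAffine`. Everything is proved; no named
facts. Mathlib searched (pin): `HomologicalComplex.exactAt_iff'`,
`ShortComplex.moduleCat_exact_iff` (used); no Čech acyclicity statements in Mathlib.

## References

* The Stacks Project, Tag 01X9 (Cohomology of Schemes, Lemma "cech-cohomology-quasi-coherent-
  trivial") and Tags 0G6S/0G6T (the contraction). [StacksProject]
* U. Görtz, T. Wedhorn, *Algebraic Geometry II: Cohomology of Schemes*, Springer Spektrum (2023),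
  doi:10.1007/978-3-658-43031-3: Def. 21.68, p. 260; Thm. 22.2, p. 328. [GortzWedhorn2023]
-/

universe u v w

open CategoryTheory Finset

namespace Literature.Algebra.Homology

namespace OrderedCech

variable {ι : Type} [LinearOrder ι]
variable {A : Type u} [CommRing A]
variable {𝕂 : Type v} [AddCommGroup 𝕂] [Module A 𝕂] {F : Finset ι → Submodule A 𝕂}
  (hF : Monotone F)

/-! ### The constant family `s ↦ 𝕂` and the inclusion `Č(F) ↪ Č(𝕂)` -/

variable (A 𝕂) in
/-- The constant family `s ↦ 𝕂` (all of the ambient module). [folklore] -/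
def topFamily : Finset ι → Submodule A 𝕂 := fun _ => ⊤

omit [LinearOrder ι] in
/-- The constant family is monotone. [folklore] -/
theorem topFamily_mono : Monotone (topFamily (ι := ι) A 𝕂) := fun _ _ _ => le_rfl

variable (F) in
/-- The inclusion of cochains of `F` into cochains of the constant family `𝕂`. [folklore] -/
def Cochain.toTop (n : ℤ) : Cochain F n →ₗ[A] Cochain (topFamily (ι := ι) A 𝕂) n :=
  Cochain.map LinearMap.id (fun _ _ _ => Submodule.mem_top) n

/-- Components of `toTop`. [folklore] -/
@[simp] theorem Cochain.coe_toTop_apply {n : ℤ} (g : Cochain F n) (σ : Simplex ι n) :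
    ((Cochain.toTop F n g) σ : 𝕂) = (g σ : 𝕂) := rfl

/-- `toTop` commutes with extension by zero. [folklore] -/
theorem Cochain.ext0_toTop {n : ℤ} (g : Cochain F n) (s : Finset ι) :
    (Cochain.toTop F n g).ext0 s = g.ext0 s :=
  Cochain.ext0_map _ _ g s

/-- `toTop` is injective. [folklore] -/
theorem Cochain.toTop_injective (n : ℤ) : Function.Injective (Cochain.toTop F n) :=
  Cochain.map_injective _ _ fun _ _ _ h => h

/-- `toTop` commutes with the differentials. [folklore] -/
theorem d_toTop {n : ℤ} (g : Cochain F n) :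
    d (topFamily A 𝕂) topFamily_mono n (Cochain.toTop F n g) =
      Cochain.toTop F (n + 1) (d F hF n g) :=
  d_map _ _ hF topFamily_mono g

/-! ### The partition-of-unity criterion for a single cocycle -/

/-- **Partition-of-unity acyclicity, cochain by cochain** (the algebraic skeleton of Stacks
Project, Tag 01X9): let `c ∈ Čⁿ⁺¹(F)` (`n ≥ 0`) be a cocycle, and let `r_k`, `a_k` (`k ∈ κ`
finite) be `A`-linear endomorphisms of `𝕂` and `i_k` vertices such that `a_k (F s) ⊆ F s`
(`s ≠ ∅`), `r_k (c_{τ ∪ i_k}) ∈ F τ` for every `n`-simplex `τ ∌ i_k`, and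
`Σ_k a_k (r_k (c_σ)) = c_σ` for every `(n+1)`-simplex `σ`. Then `c = d b` with
`b = Σ_k a_k (h_k c) ∈ Čⁿ(F)`, `h_k` the cone contraction with vertex `i_k` twisted by `r_k`
(computed in `Č(𝕂)`, `d_coneHom_add_coneHom_d`). [cite: StacksProject, Tag 01X9 (proof)] -/
theorem exists_d_eq_of_partition_of_cochain {κ : Type w} [Fintype κ]
    (r a : κ → (𝕂 →ₗ[A] 𝕂)) (i : κ → ι)
    (ha : ∀ k (s : Finset ι), s.Nonempty → ∀ x ∈ F s, a k x ∈ F s)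
    {n : ℤ} (hn : 0 ≤ n) (c : Cochain F (n + 1)) (hc : d F hF (n + 1) c = 0)
    (hr : ∀ k (τ : Simplex ι n), i k ∉ τ.1 → r k (c.ext0 (insert (i k) τ.1)) ∈ F τ.1)
    (hsum : ∀ σ : Simplex ι (n + 1), ∑ k, a k (r k (c σ : 𝕂)) = c σ) :
    ∃ b : Cochain F n, d F hF n b = c := by
  -- work in the Čech complex of the constant family `𝕂`
  set c' : Cochain (topFamily (ι := ι) A 𝕂) (n + 1) := Cochain.toTop F (n + 1) c with hc'
  have hdc' : d (topFamily A 𝕂) topFamily_mono (n + 1) c' = 0 := by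
    rw [hc', d_toTop hF, hc, map_zero]
  have htop : ∀ (k : κ) (s : Finset ι), s.Nonempty → ∀ x ∈ topFamily (ι := ι) A 𝕂 (insert (i k) s),
      r k x ∈ topFamily (ι := ι) A 𝕂 s := fun _ _ _ _ _ => Submodule.mem_top
  have htopa : ∀ (k : κ) (s : Finset ι), s.Nonempty → ∀ x ∈ topFamily (ι := ι) A 𝕂 s,
      a k x ∈ topFamily (ι := ι) A 𝕂 s := fun _ _ _ _ _ => Submodule.mem_top
  set b' : Cochain (topFamily (ι := ι) A 𝕂) n :=
    ∑ k, Cochain.mapEnd (a k) (htopa k) n (coneHom (r k) (i k) (htop k) n c') with hb'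
  -- `d b' = c'`
  have hdb' : d (topFamily A 𝕂) topFamily_mono n b' = c' := by
    rw [hb', map_sum]
    have hk : ∀ k, d (topFamily A 𝕂) topFamily_mono n
        (Cochain.mapEnd (a k) (htopa k) n (coneHom (r k) (i k) (htop k) n c')) =
        Cochain.mapEnd (a k) (htopa k) (n + 1)
          (Cochain.mapEnd (r k) (mapsTo_of_insert topFamily_mono (r k) (i k) (htop k))
            (n + 1) c') := fun k => by
      rw [d_mapEnd _ topFamily_mono,
        ← d_coneHom_add_coneHom_d topFamily_mono (r k) (i k) (htop k) hn c', hdc', map_zero,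
        add_zero]
    simp_rw [hk]
    funext σ
    apply Subtype.ext
    rw [Cochain.coe_sum_apply]
    exact hsum σ
  -- the components of `b'` lie in the `F τ`
  have hmem : ∀ τ : Simplex ι n, (b' τ : 𝕂) ∈ F τ.1 := fun τ => by
    rw [hb', Cochain.coe_sum_apply]
    refine Submodule.sum_mem _ fun k _ => ?_
    rw [Cochain.coe_mapEnd_apply]
    refine ha k τ.1 τ.2.1 _ ?_
    by_cases hik : i k ∈ τ.1
    · rw [coe_coneHom_apply_of_mem (r k) (i k) (htop k) c' τ hik]
      exact zero_mem _
    · rw [coe_coneHom_apply_of_not_mem (r k) (i k) (htop k) c' τ hik, hc', Cochain.ext0_toTop]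
      exact Submodule.smul_mem _ _ (hr k τ hik)
  refine ⟨fun τ => ⟨(b' τ : 𝕂), hmem τ⟩, Cochain.toTop_injective (n + 1) ?_⟩
  rw [← d_toTop hF, ← hc', ← hdb']
  rfl

/-! ### Exactness from the solvability of `d b = c` -/

/-- **`Č•(F)` is exact in all degrees `≠ 0` as soon as every cocycle of positive degree is a
coboundary** (bookkeeping between `OrderedCech.d` and `HomologicalComplex.ExactAt`). [folklore] -/
theorem exactAt_of_forall_exists_d_eq
    (H : ∀ n : ℤ, 0 ≤ n → ∀ c : Cochain F (n + 1), d F hF (n + 1) c = 0 →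
      ∃ b : Cochain F n, d F hF n b = c)
    (m : ℤ) (hm : m ≠ 0) : (complex F hF).ExactAt m := by
  rcases lt_or_gt_of_ne hm with hm' | hm'
  · exact HomologicalComplex.ExactAt.of_isZero (isZero_complex_X_of_neg F hF m hm')
  · obtain ⟨n, rfl⟩ : ∃ n : ℤ, m = n + 1 := ⟨m - 1, by ring⟩
    have hn : 0 ≤ n := by omega
    rw [HomologicalComplex.exactAt_iff' _ (n + 1) (i := n) (k := n + 1 + 1) (by simp) (by simp),
      ShortComplex.moduleCat_exact_iff]
    intro x hx
    change ((complex F hF).d (n + 1) (n + 1 + 1)) x = 0 at hx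
    rw [complex_d] at hx
    change d F hF (n + 1) x = 0 at hx
    obtain ⟨b, hb⟩ := H n hn x hx
    refine ⟨b, ?_⟩
    change ((complex F hF).d n (n + 1)) b = x
    rw [complex_d]
    exact hb

end OrderedCech

end Literature.Algebra.Homology
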